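import Mathlib
import HarnessLib
import Summits.Parity.GeneralizedHardyLittlewood.Theorems.LeeYangFibresAbsoluteUpgradeDefs
import Summits.Parity.GeneralizedHardyLittlewood.Theorems.LeeYangFibresModelCellFacts
import Literature.NumberTheory.Sieve.RoughNumbersCoprimeProgressions
import Literature.NumberTheory.Sieve.SieveFrameworkFundamentalLemma
import Literature.NumberTheory.LFunctions.MertensElementary
import Literature.NumberTheory.Sieve.MoebiusShiftedPrimesDecomposition

/-!
# Route `LeeYangFibres`, crux `AbsoluteUpgrade` (stmt-Parity-14116), line
# `nlc-cells-absolute-clip`: the stub `RoughAnatomy`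

Parity-free anatomy of the rough `Ω`-cells `A_m(N) = #{n ≤ N : P⁻(n) > N^{1/u}, Ω(n) = m}`
(`roughCell N u m`), uniformly along the slow range `4 ≤ u ≤ A log log log N`:
(a) `A_m(N) ≥ c N/log N`, `m = 1, 2, 3`: the cell at roughness `u ≥ 4` contains the cell at the
FIXED roughness `4` (`roughCell_four_le`), where Alladi's `A_m(N) log N / N → I_m(4) > 0` is in
the tree (`ModelCellFacts.eventually_lower`, `calc_pos`); (b) `A_1(N) ≤ π(N) ≤ 2N/log N`
(Chebyshev, tree `Lichtman2020.eventually_primeCounting_le_two`);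
(c) `Σ_{1 ≤ m ≤ u} A_m(N) = Φ(N, N^{1/u}) ≥ c u N/log N`: the cells partition the `N^{1/u}`-rough
integers of `[2, N]` (`Ω(n) < u` as `N^{Ω(n)/u} < n ≤ N`); for `u < u₁` the primes alone suffice,
and for `u ≥ u₁` the lower-bound Fundamental Lemma in dimension `1` (`BFI.roughCount_approx`,
`k = 1`, `D = √N`, `z' = ⌊N^{1/u}⌋ + 1`, `log D/log z' ≥ u/4`, discharged by
`SieveSequence.fundamental_lemma_uniform_holds`) with the elementary lower half of Mertens'
product theorem (`MertensBound.exp_neg_div_log_le_prod_one_sub_inv`) gives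
`Φ ≥ ½ N W(z') − √N − 1 ≥ (e^{-5}/4) u N/log N`; the slow range enters only via `2^u ≤ N`.
References: Alladi 1982 [Alladi1982]; Tenenbaum III.6 [Tenenbaum2015]; Friedlander–Iwaniec,
Opera de Cribro, Cor. 6.10 [FriedlanderIwaniecOpera2010]. Unconditional; no named facts used.
-/
noncomputable section

open scoped BigOperators Classical
open Finset Filter

namespace Summit.Parity.GeneralizedHardyLittlewood.Theorems.AbsoluteUpgrade

open Summit.Parity.GeneralizedHardyLittlewood.Cruxes.AbsoluteUpgrade.NlcCellsAbsoluteClip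
open Literature.NumberTheory.Sieve
open Summit.Parity.GeneralizedHardyLittlewood.Cruxes.ModelHyperbolicity.WindowChainTransport
  (cellDensity calc_pos)
open Summit.Parity.GeneralizedHardyLittlewood.Theorems.ModelCellFacts

/-- Monotonicity in the roughness: for `4 ≤ u` and `N ≥ 1` the threshold `N^{1/u} ≤ N^{1/4}` is
weaker, so the cell at roughness `u` contains the cell at roughness `4`. -/
theorem roughCell_four_le {N u : ℕ} (hN : 1 ≤ N) (hu : 4 ≤ u) (m : ℕ) :
    roughCell N 4 m ≤ roughCell N u m := by
  have hle : (N : ℝ) ^ ((1 : ℝ) / u) ≤ (N : ℝ) ^ ((1 : ℝ) / (4 : ℕ)) := by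
    refine Real.rpow_le_rpow_of_exponent_le (by exact_mod_cast hN) ?_
    have h4 : ((4 : ℕ) : ℝ) ≤ u := by exact_mod_cast hu
    exact one_div_le_one_div_of_le (by norm_num) h4
  unfold roughCell
  refine Finset.card_le_card fun n hn => ?_
  rw [Finset.mem_filter] at hn ⊢
  exact ⟨hn.1, hle.trans_lt hn.2.1, hn.2.2⟩

/-- The three corner cells at the fixed roughness `u = 4` are `≫ N/log N`: Alladi's
`A_m(N) log N/N → I_m(4) > 0` for `m = 1, 2, 3` (tree `ModelCellFacts.eventually_lower`;
`roughCell N 4 m` is definitionally the cell `cell 4 N m` of `ModelHyperbolicityLoadBearing`). -/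
theorem exists_corner_lower :
    ∃ c : ℝ, 0 < c ∧ ∀ᶠ N : ℕ in atTop, ∀ m ∈ ({1, 2, 3} : Finset ℕ),
      c * (N : ℝ) / Real.log N ≤ (roughCell N 4 m : ℝ) := by
  obtain ⟨c, hc, hclt⟩ :
      ∃ c : ℝ, 0 < c ∧ ∀ j ∈ Finset.Ico 1 4, c < cellDensity (j - 1) ((4 : ℕ) : ℝ) := by
    refine exists_pos_forall_lt fun j hj => ?_
    obtain ⟨hj1, hj4⟩ := Finset.mem_Ico.mp hj
    refine calc_pos (j - 1) _ ?_
    have : ((j - 1 : ℕ) : ℝ) + 1 = j := by rw [Nat.cast_sub hj1]; push_cast; ring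
    rw [this]; exact_mod_cast hj4
  refine ⟨c, hc, ?_⟩
  filter_upwards [eventually_lower (u := 4) (by norm_num) hclt] with N hN m hm
  have hm' : m ∈ Finset.Ico 1 4 := by
    simp only [Finset.mem_insert, Finset.mem_singleton] at hm
    simp only [Finset.mem_Ico]; omega
  exact hN m hm'

/-- A rough integer with `Ω = 1` is a prime: `A_1(N) ≤ π(N)` at every roughness. -/
theorem roughCell_one_le_primeCounting (N u : ℕ) : roughCell N u 1 ≤ Nat.primeCounting N := by
  rw [← Nat.primesLE_card_eq_primeCounting]
  unfold roughCell
  refine Finset.card_le_card fun n hn => ?_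
  rw [Finset.mem_filter, Finset.mem_Icc] at hn
  rw [Nat.mem_primesLE]
  exact ⟨hn.1.2, ArithmeticFunction.cardFactors_eq_one_iff_prime.mp hn.2.2⟩

/-- Every `N^{1/u}`-rough `n ∈ [1, N]` (`N ≥ 2`, `u ≥ 1`) has `1 ≤ Ω(n) ≤ u`:
`n ≠ 1` since `P⁻(1) = 1 ≤ N^{1/u}`, and `N^{Ω(n)/u} < P⁻(n)^{Ω(n)} ≤ n ≤ N`. -/
theorem cardFactors_mem_Icc_of_rough {N u n : ℕ} (hN : 2 ≤ N) (hu : 1 ≤ u)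
    (hn : n ∈ Finset.Icc 1 N) (hrough : (N : ℝ) ^ ((1 : ℝ) / u) < (Nat.minFac n : ℝ)) :
    ArithmeticFunction.cardFactors n ∈ Finset.Icc 1 u := by
  set z : ℝ := (N : ℝ) ^ ((1 : ℝ) / u) with hz
  have hN1 : (1 : ℝ) ≤ N := by exact_mod_cast (show 1 ≤ N by omega)
  have hz1 : 1 ≤ z := Real.one_le_rpow hN1 (by positivity)
  obtain ⟨hn1, hnN⟩ := Finset.mem_Icc.mp hn
  have hn2 : 2 ≤ n := by
    by_contra h
    obtain rfl : n = 1 := by omega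
    rw [Nat.minFac_one, Nat.cast_one] at hrough
    exact absurd hz1 (not_le.mpr hrough)
  rw [Finset.mem_Icc]
  refine ⟨Nat.succ_le_of_lt (ArithmeticFunction.cardFactors_pos_iff_one_lt.mpr (by omega)), ?_⟩
  by_contra hlt
  rw [not_le] at hlt
  have hpow : Nat.minFac n ^ ArithmeticFunction.cardFactors n ≤ n := by
    rw [ArithmeticFunction.cardFactors_apply]
    conv_rhs => rw [← Nat.prod_primeFactorsList (show n ≠ 0 by omega)]
    exact List.pow_card_le_prod _ _ fun p hp =>
      Nat.minFac_le_of_dvd (Nat.prime_of_mem_primeFactorsList hp).two_le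
        (Nat.dvd_of_mem_primeFactorsList hp)
  -- `z^u ≤ z^{Ω(n)} < P⁻(n)^{Ω(n)} ≤ n ≤ N = z^u`
  have hzu : z ^ u = N := by
    rw [hz, one_div, Real.rpow_inv_natCast_pow (by positivity) (by omega)]
  have h1 : z ^ u ≤ z ^ ArithmeticFunction.cardFactors n := pow_le_pow_right₀ hz1 hlt.le
  have h2 : z ^ ArithmeticFunction.cardFactors n <
      (Nat.minFac n : ℝ) ^ ArithmeticFunction.cardFactors n :=
    pow_lt_pow_left₀ hrough (by positivity) (by omega)
  linarith [(by exact_mod_cast hpow : (Nat.minFac n : ℝ) ^ ArithmeticFunction.cardFactors n ≤ n),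
    (by exact_mod_cast hnN : (n : ℝ) ≤ N)]

/-- The cells `m = 1, …, u` partition the rough integers:
`Σ_{1 ≤ m ≤ u} A_m(N) = Φ(N, N^{1/u}) = #{n ≤ N : P⁻(n) > N^{1/u}}` (`N ≥ 2`, `u ≥ 1`). -/
theorem sum_roughCell_eq_card {N u : ℕ} (hN : 2 ≤ N) (hu : 1 ≤ u) :
    ∑ m ∈ Finset.Icc 1 u, (roughCell N u m : ℝ) =
      (((Finset.Icc 1 N).filter
        (fun n => (N : ℝ) ^ ((1 : ℝ) / u) < (Nat.minFac n : ℝ))).card : ℝ) := by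
  symm
  rw [Finset.card_eq_sum_card_fiberwise (t := Finset.Icc 1 u)
      (f := fun n : ℕ => ArithmeticFunction.cardFactors n) ?maps]
  · push_cast
    refine Finset.sum_congr rfl fun m _ => ?_
    rw [roughCell, Finset.filter_filter]
  · intro n hn
    have hn' := Finset.mem_filter.mp (Finset.mem_coe.mp hn)
    exact cardFactors_mem_Icc_of_rough hN hu hn'.1 hn'.2

/-- With `z' = ⌊N^{1/u}⌋ + 1`, every `m ∈ (0, N]` coprime to `P(z') = ∏_{p ≤ ⌊N^{1/u}⌋} p`
other than `m = 1` is `N^{1/u}`-rough: `roughCount 0 N 1 1 z' ≤ Φ(N, N^{1/u}) + 1`. -/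
theorem roughCount_le_card_add_one (N u : ℕ) :
    BFI.roughCount 0 N 1 1 (((⌊(N : ℝ) ^ ((1 : ℝ) / u)⌋₊ + 1 : ℕ) : ℝ)) ≤
      ((Finset.Icc 1 N).filter
        (fun n => (N : ℝ) ^ ((1 : ℝ) / u) < (Nat.minFac n : ℝ))).card + 1 := by
  set z : ℝ := (N : ℝ) ^ ((1 : ℝ) / u) with hz
  set S := (Finset.Ioc 0 N).filter (fun m : ℕ => (m : ZMod 1) = 1 ∧
    m.Coprime (primesProdBelow (((⌊z⌋₊ + 1 : ℕ) : ℝ)))) with hS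
  have hsub : S.erase 1 ⊆ (Finset.Icc 1 N).filter (fun n => z < (Nat.minFac n : ℝ)) := by
    intro m hm
    obtain ⟨hm1, hmS⟩ := Finset.mem_erase.mp hm
    rw [hS, Finset.mem_filter, Finset.mem_Ioc] at hmS
    obtain ⟨⟨hm0, hmN⟩, -, hcop⟩ := hmS
    rw [Finset.mem_filter, Finset.mem_Icc]
    refine ⟨⟨hm0, hmN⟩, ?_⟩
    rw [coprime_primesProdBelow_iff, Nat.ceil_natCast] at hcop
    have hnot : ¬ (Nat.minFac m < ⌊z⌋₊ + 1) := fun hlt =>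
      hcop _ (Nat.mem_primesBelow.mpr ⟨hlt, Nat.minFac_prime hm1⟩) (Nat.minFac_dvd m)
    calc z < (⌊z⌋₊ : ℝ) + 1 := Nat.lt_floor_add_one z
      _ = ((⌊z⌋₊ + 1 : ℕ) : ℝ) := by push_cast; ring
      _ ≤ (Nat.minFac m : ℝ) := by exact_mod_cast not_lt.mp hnot
  have h1 : S.card ≤ (S.erase 1).card + 1 := by
    have := Finset.pred_card_le_card_erase (s := S) (a := 1); omega
  exact h1.trans (Nat.add_le_add_right (Finset.card_le_card hsub) 1)

/-- Mertens, lower half, at `z' = ⌊z⌋ + 1`: `W_1(z') = ∏_{p ≤ ⌊z⌋} (1 − 1/p) ≥ e^{-5}/log z`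
for `z ≥ 2` (tree `MertensBound.exp_neg_div_log_le_prod_one_sub_inv`). -/
theorem roughDensity_one_ge {z : ℝ} (hz : 2 ≤ z) :
    Real.exp (-5) / Real.log z ≤ BFI.roughDensity 1 (((⌊z⌋₊ + 1 : ℕ) : ℝ)) := by
  have hfl2 : 2 ≤ ⌊z⌋₊ := Nat.le_floor (by exact_mod_cast hz)
  have hfl0 : (0 : ℝ) < ⌊z⌋₊ := by exact_mod_cast (show 0 < ⌊z⌋₊ by omega)
  have hlogfl : 0 < Real.log (⌊z⌋₊ : ℝ) :=
    Real.log_pos (by exact_mod_cast (show 1 < ⌊z⌋₊ by omega))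
  have hprod : BFI.roughDensity 1 (((⌊z⌋₊ + 1 : ℕ) : ℝ)) =
      ∏ p ∈ Nat.primesLE ⌊z⌋₊, (1 - 1 / (p : ℝ)) := by
    rw [BFI.roughDensity, Nat.ceil_natCast]
    refine Finset.prod_congr rfl fun p _ => ?_
    rw [BFI.coprimeRecip_apply, if_pos (Nat.coprime_one_right p), one_div]
  rw [hprod]
  calc Real.exp (-5) / Real.log z ≤ Real.exp (-5) / Real.log (⌊z⌋₊ : ℝ) :=
        div_le_div_of_nonneg_left (Real.exp_pos _).le hlogfl
          (Real.log_le_log hfl0 (Nat.floor_le (by linarith)))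
    _ ≤ _ :=
        Literature.NumberTheory.LFunctions.MertensBound.exp_neg_div_log_le_prod_one_sub_inv _ hfl2

/-- **Lower-bound Fundamental Lemma for the rough integers, uniform in the roughness.** There
are `u₁` and `N₃` such that for `N ≥ N₃`, `u ≥ max u₁ 4` and `2 ≤ N^{1/u}`:
`Φ(N, N^{1/u}) ≥ (e^{-5}/4) · u · N/log N` (`BFI.roughCount_approx` at `k = 1`, `D = √N`,
`z' = ⌊N^{1/u}⌋ + 1`, where `log D/log z' ≥ u/4` and `C₀ e^{-u/4} ≤ ½` for `u ≥ u₁`; Mertens). -/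
theorem exists_rough_lower :
    ∃ u₁ N₃ : ℕ, ∀ N : ℕ, N₃ ≤ N → ∀ u : ℕ, u₁ ≤ u → 4 ≤ u →
      (2 : ℝ) ≤ (N : ℝ) ^ ((1 : ℝ) / u) →
        Real.exp (-5) / 4 * u * N / Real.log N ≤
          (((Finset.Icc 1 N).filter
            (fun n => (N : ℝ) ^ ((1 : ℝ) / u) < (Nat.minFac n : ℝ))).card : ℝ) := by
  obtain ⟨C₀, hC₀, hFL⟩ := BFI.roughCount_approx SieveSequence.fundamental_lemma_uniform_holds
  obtain ⟨u₁, hu₁⟩ := exists_nat_ge (4 * Real.log (2 * C₀))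
  -- `N₃`: `16 ≤ N` and `√N + 1 ≤ (e^{-5}/4) N/log N` (`log N = o(√N)`)
  have hκ : (0 : ℝ) < Real.exp (-5) / 4 / 2 := by positivity
  have ho := (isLittleO_log_rpow_atTop (by norm_num : (0 : ℝ) < 1 / 2)).bound hκ
  have hev : ∀ᶠ N : ℕ in atTop, 16 ≤ N ∧
      Real.sqrt N + 1 ≤ Real.exp (-5) / 4 * N / Real.log N := by
    filter_upwards [tendsto_natCast_atTop_atTop.eventually ho, eventually_ge_atTop 16] with N hN
      hN16
    refine ⟨hN16, ?_⟩
    have hN1 : (1 : ℝ) ≤ N := by exact_mod_cast (show 1 ≤ N by omega)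
    have hlogN : 0 < Real.log N := Real.log_pos (by exact_mod_cast (show 1 < N by omega))
    rw [← Real.sqrt_eq_rpow, Real.norm_of_nonneg hlogN.le,
      Real.norm_of_nonneg (Real.sqrt_nonneg _)] at hN
    have hs1 : 1 ≤ Real.sqrt N := Real.one_le_sqrt.mpr hN1
    rw [le_div_iff₀ hlogN]
    calc (Real.sqrt N + 1) * Real.log N ≤ (2 * Real.sqrt N) * Real.log N :=
          mul_le_mul_of_nonneg_right (by linarith) hlogN.le
      _ ≤ (2 * Real.sqrt N) * (Real.exp (-5) / 4 / 2 * Real.sqrt N) :=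
          mul_le_mul_of_nonneg_left hN (by positivity)
      _ = Real.exp (-5) / 4 * (Real.sqrt N * Real.sqrt N) := by ring
      _ = Real.exp (-5) / 4 * N := by rw [Real.mul_self_sqrt (by linarith)]
  obtain ⟨N₃, hN₃⟩ := Filter.eventually_atTop.mp hev
  refine ⟨u₁, N₃, fun N hN u hu hu4 hz2 => ?_⟩
  obtain ⟨hN16, hsqrt⟩ := hN₃ N hN
  set z : ℝ := (N : ℝ) ^ ((1 : ℝ) / u) with hz
  set z' : ℝ := ((⌊z⌋₊ + 1 : ℕ) : ℝ) with hz'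
  set D : ℝ := Real.sqrt N with hD
  have hN0 : (0 : ℝ) < N := by exact_mod_cast (show 0 < N by omega)
  have hN1 : (1 : ℝ) ≤ N := by exact_mod_cast (show 1 ≤ N by omega)
  have hlogN : 0 < Real.log N := Real.log_pos (by exact_mod_cast (show 1 < N by omega))
  have hu0 : (0 : ℝ) < u := by exact_mod_cast (show 0 < u by omega)
  have hu1' : (1 : ℝ) ≤ u := by exact_mod_cast (show 1 ≤ u by omega)
  have hlogz : Real.log z = Real.log N / u := by rw [hz, Real.log_rpow hN0]; ring
  have hz'le : z' ≤ 2 * z := by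
    rw [hz']; push_cast; linarith [Nat.floor_le (show (0 : ℝ) ≤ z by linarith)]
  have hzz' : z < z' := by rw [hz']; push_cast; exact Nat.lt_floor_add_one z
  have hz'2 : 2 ≤ z' := by linarith
  have hlogz' : Real.log z' ≤ 2 * Real.log z := by
    calc Real.log z' ≤ Real.log (2 * z) := Real.log_le_log (by linarith) hz'le
      _ = Real.log 2 + Real.log z := Real.log_mul (by norm_num) (by linarith)
      _ ≤ 2 * Real.log z := by linarith [Real.log_le_log two_pos hz2]
  have hlogz'_pos : 0 < Real.log z' := Real.log_pos (by linarith)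
  -- the level `D = √N = N^{1/4} · N^{1/4} ≥ 2 z ≥ z'`
  have hN4 : (2 : ℝ) ≤ (N : ℝ) ^ ((1 : ℝ) / 4) := by
    rw [Real.le_rpow_iff_log_le two_pos hN0]
    have h16 : Real.log 16 ≤ Real.log N := Real.log_le_log (by norm_num) (by exact_mod_cast hN16)
    have : Real.log 16 = 4 * Real.log 2 := by
      rw [show (16 : ℝ) = 2 ^ 4 by norm_num, Real.log_pow]; push_cast; ring
    linarith
  have hzN4 : z ≤ (N : ℝ) ^ ((1 : ℝ) / 4) := Real.rpow_le_rpow_of_exponent_le hN1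
    (one_div_le_one_div_of_le (by norm_num) (by exact_mod_cast hu4))
  have hz'D : z' ≤ D := by
    calc z' ≤ 2 * z := hz'le
      _ ≤ (N : ℝ) ^ ((1 : ℝ) / 4) * (N : ℝ) ^ ((1 : ℝ) / 4) :=
          mul_le_mul hN4 hzN4 (by linarith) (by positivity)
      _ = D := by rw [hD, Real.sqrt_eq_rpow, ← Real.rpow_add hN0]; norm_num
  have hlogD : Real.log D = Real.log N / 2 := by rw [hD, Real.log_sqrt hN0.le]
  -- the saving `e^{-s}`, `s = log D / log z' ≥ u/4 ≥ log (2 C₀)`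
  have hexp : Real.exp (-(Real.log D / Real.log z')) ≤ 1 / (2 * C₀) := by
    have hs : (u : ℝ) / 4 ≤ Real.log D / Real.log z' := by
      rw [hlogD]
      calc (u : ℝ) / 4 = Real.log N / 2 / (2 * Real.log z) := by rw [hlogz]; field_simp; ring
        _ ≤ Real.log N / 2 / Real.log z' :=
            div_le_div_of_nonneg_left (by positivity) hlogz'_pos hlogz'
    have hu' : (u₁ : ℝ) ≤ u := by exact_mod_cast hu
    calc Real.exp (-(Real.log D / Real.log z')) ≤ Real.exp (-Real.log (2 * C₀)) :=
          Real.exp_le_exp.mpr (by linarith)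
      _ = 1 / (2 * C₀) := by rw [Real.exp_neg, Real.exp_log (by positivity), one_div]
  have hmain := hFL 1 one_pos 1 isUnit_one 0 N (Nat.zero_le N) z' D hz'2 hz'D
  simp only [Nat.cast_zero, sub_zero, Nat.cast_one, div_one] at hmain
  set S : ℝ := (BFI.roughCount 0 N 1 1 z' : ℝ) with hS
  set W : ℝ := BFI.roughDensity 1 z' with hW
  have hW0 : 0 ≤ W := BFI.roughDensity_nonneg 1 z'
  have hS1 : (N : ℝ) * W / 2 - D ≤ S := by
    have h1 : (N : ℝ) * W - (C₀ * N * W * Real.exp (-(Real.log D / Real.log z')) + D) ≤ S := by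
      linarith [(abs_le.mp hmain).1]
    have h2 : C₀ * N * W * Real.exp (-(Real.log D / Real.log z')) ≤ N * W / 2 := by
      calc C₀ * N * W * Real.exp (-(Real.log D / Real.log z'))
            ≤ C₀ * N * W * (1 / (2 * C₀)) := mul_le_mul_of_nonneg_left hexp (by positivity)
        _ = N * W / 2 := by field_simp
    linarith
  -- Mertens: `N W ≥ e^{-5} u N / log N`
  have hNW : Real.exp (-5) * u * N / Real.log N ≤ N * W := by
    have h := roughDensity_one_ge hz2
    rw [hlogz] at h
    calc Real.exp (-5) * u * N / Real.log N = N * (Real.exp (-5) / (Real.log N / u)) := by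
          field_simp
      _ ≤ N * W := mul_le_mul_of_nonneg_left h hN0.le
  have hR : S - 1 ≤ (((Finset.Icc 1 N).filter
      (fun n => (N : ℝ) ^ ((1 : ℝ) / u) < (Nat.minFac n : ℝ))).card : ℝ) := by
    rw [sub_le_iff_le_add, hS, hz', hz]
    exact_mod_cast roughCount_le_card_add_one N u
  -- the small terms: `√N + 1 ≤ (e^{-5}/4) N/log N ≤ (e^{-5}/4) u N/log N`
  have hsmall : D + 1 ≤ Real.exp (-5) / 4 * u * N / Real.log N := by
    calc D + 1 ≤ Real.exp (-5) / 4 * N / Real.log N := hsqrt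
      _ = 1 * (Real.exp (-5) / 4 * N / Real.log N) := (one_mul _).symm
      _ ≤ u * (Real.exp (-5) / 4 * N / Real.log N) :=
          mul_le_mul_of_nonneg_right hu1' (by positivity)
      _ = Real.exp (-5) / 4 * u * N / Real.log N := by ring
  have hid : Real.exp (-5) / 4 * u * N / Real.log N =
      Real.exp (-5) * u * N / Real.log N / 2 - Real.exp (-5) / 4 * u * N / Real.log N := by ring
  linarith

/-- For every real `B`, eventually `B · log log log N ≤ log N`; along the slow range
`u ≤ A log₃ N` this gives `2^u ≤ N`, i.e. `N^{1/u} ≥ 2` (with `B = A log 2`). -/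
theorem eventually_mul_logloglog_le (B : ℝ) :
    ∀ᶠ N : ℕ in atTop, B * Real.log (Real.log (Real.log N)) ≤ Real.log N := by
  have h1 : ∀ᶠ t : ℝ in atTop, |B| * |Real.log t| ≤ t := by
    have ho := Real.isLittleO_log_id_atTop.bound (show (0 : ℝ) < 1 / (|B| + 1) by positivity)
    filter_upwards [ho, eventually_ge_atTop (0 : ℝ)] with t ht ht0
    simp only [id, Real.norm_eq_abs, abs_of_nonneg ht0] at ht
    calc |B| * |Real.log t| ≤ |B| * (1 / (|B| + 1) * t) :=
          mul_le_mul_of_nonneg_left ht (abs_nonneg B)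
      _ = |B| / (|B| + 1) * t := by ring
      _ ≤ 1 * t := by
          refine mul_le_mul_of_nonneg_right ?_ ht0
          rw [div_le_one (by positivity)]; linarith
      _ = t := one_mul t
  have hl : Tendsto (fun N : ℕ => Real.log (N : ℝ)) atTop atTop :=
    Real.tendsto_log_atTop.comp tendsto_natCast_atTop_atTop
  filter_upwards [(Real.tendsto_log_atTop.comp hl).eventually h1,
    hl.eventually (eventually_gt_atTop 0)] with N hN hlpos
  have h2 : Real.log (Real.log (N : ℝ)) ≤ Real.log N :=
    (Real.log_le_sub_one_of_pos hlpos).trans (by linarith)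
  calc B * Real.log (Real.log (Real.log N)) ≤ |B| * |Real.log (Real.log (Real.log N))| := by
        rw [← abs_mul]; exact le_abs_self _
    _ ≤ Real.log (Real.log N) := hN
    _ ≤ Real.log N := h2

/-- **`RoughAnatomy` (stub `stub_roughAnatomy` of the line `nlc-cells-absolute-clip`).** For
every `A` there is `c > 0` with, for `N ≥ N₀` and `4 ≤ u ≤ A log log log N`: `A_m(N) ≥ c N/log N`
for `m = 1, 2, 3`, `A_1(N) ≤ 2N/log N`, and `Σ_{1 ≤ m ≤ u} A_m(N) ≥ c u N/log N`. Unconditional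
(Alladi's cell asymptotics at `u = 4`, Chebyshev, the dimension-one Fundamental Lemma, Mertens). -/
theorem stub_roughAnatomy : RoughAnatomy := by
  intro A
  obtain ⟨c₄, hc₄, hcorner⟩ := exists_corner_lower
  obtain ⟨u₁, N₃, hrough⟩ := exists_rough_lower
  obtain ⟨N₀, hN₀⟩ := Filter.eventually_atTop.mp
    (hcorner.and (Lichtman2020.eventually_primeCounting_le_two.and
      ((eventually_mul_logloglog_le (A * Real.log 2)).and (eventually_ge_atTop (max N₃ 2)))))
  set c : ℝ := min c₄ (min (c₄ / (u₁ + 1)) (Real.exp (-5) / 4)) with hc_def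
  have hc1 : c ≤ c₄ := min_le_left _ _
  have hc2 : c ≤ c₄ / (u₁ + 1) := (min_le_right _ _).trans (min_le_left _ _)
  have hc3 : c ≤ Real.exp (-5) / 4 := (min_le_right _ _).trans (min_le_right _ _)
  refine ⟨c, lt_min hc₄ (lt_min (by positivity) (by positivity)), N₀, fun N hN u hu4 huA => ?_⟩
  obtain ⟨hA, hB, hC, hmax⟩ := hN₀ N hN
  have hN2 : 2 ≤ N := le_of_max_le_right hmax
  have hN0 : (0 : ℝ) < N := by exact_mod_cast (show 0 < N by omega)
  have hlogN : 0 < Real.log N := Real.log_pos (by exact_mod_cast (show 1 < N by omega))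
  have hK0 : 0 ≤ (N : ℝ) / Real.log N := by positivity
  have hu0 : (0 : ℝ) < u := by exact_mod_cast (show 0 < u by omega)
  have ha : ∀ m ∈ ({1, 2, 3} : Finset ℕ), c * N / Real.log N ≤ (roughCell N u m : ℝ) := by
    intro m hm
    calc c * N / Real.log N ≤ c₄ * N / Real.log N := by
          rw [mul_div_assoc, mul_div_assoc]; exact mul_le_mul_of_nonneg_right hc1 hK0
      _ ≤ (roughCell N 4 m : ℝ) := hA m hm
      _ ≤ (roughCell N u m : ℝ) := by exact_mod_cast roughCell_four_le (by omega) hu4 m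
  refine ⟨ha, ?_, ?_⟩
  · calc (roughCell N u 1 : ℝ) ≤ (Nat.primeCounting N : ℝ) := by
          exact_mod_cast roughCell_one_le_primeCounting N u
      _ ≤ 2 * N / Real.log N := hB
  -- (c): first `N^{1/u} ≥ 2` from the slow range
  have hz2 : (2 : ℝ) ≤ (N : ℝ) ^ ((1 : ℝ) / u) := by
    rw [Real.le_rpow_iff_log_le two_pos hN0, one_div, inv_mul_eq_div, le_div_iff₀ hu0]
    calc Real.log 2 * u ≤ Real.log 2 * (A * Real.log (Real.log (Real.log N))) :=
          mul_le_mul_of_nonneg_left huA (Real.log_pos one_lt_two).le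
      _ = A * Real.log 2 * Real.log (Real.log (Real.log N)) := by ring
      _ ≤ Real.log N := hC
  rcases le_or_gt u₁ u with hu1 | hu1
  · -- regime `u ≥ u₁`: the Fundamental Lemma
    rw [sum_roughCell_eq_card hN2 (by omega)]
    calc c * u * N / Real.log N = c * (u * (N / Real.log N)) := by ring
      _ ≤ Real.exp (-5) / 4 * (u * (N / Real.log N)) :=
          mul_le_mul_of_nonneg_right hc3 (by positivity)
      _ = Real.exp (-5) / 4 * u * N / Real.log N := by ring
      _ ≤ _ := hrough N (le_of_max_le_left hmax) u hu1 hu4 hz2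
  · -- regime `4 ≤ u < u₁`: the primes alone
    have hsingle : (roughCell N u 1 : ℝ) ≤ ∑ m ∈ Finset.Icc 1 u, (roughCell N u m : ℝ) :=
      Finset.single_le_sum (f := fun m => (roughCell N u m : ℝ)) (fun m _ => Nat.cast_nonneg _)
        (Finset.mem_Icc.mpr ⟨le_rfl, by omega⟩)
    have hcu : c * u ≤ c₄ := by
      have hu' : (u : ℝ) ≤ u₁ + 1 := by exact_mod_cast (show u ≤ u₁ + 1 by omega)
      calc c * u ≤ c₄ / (u₁ + 1) * (u₁ + 1) := mul_le_mul hc2 hu' hu0.le (by positivity)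
        _ = c₄ := by field_simp
    calc c * u * N / Real.log N = c * u * (N / Real.log N) := by ring
      _ ≤ c₄ * (N / Real.log N) := mul_le_mul_of_nonneg_right hcu hK0
      _ = c₄ * N / Real.log N := by ring
      _ ≤ (roughCell N 4 1 : ℝ) := hA 1 (by simp)
      _ ≤ (roughCell N u 1 : ℝ) := by exact_mod_cast roughCell_four_le (by omega) hu4 1
      _ ≤ _ := hsingle

end Summit.Parity.GeneralizedHardyLittlewood.Theorems.AbsoluteUpgrade

end
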